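import Mathlib.LinearAlgebra.Dimension.Finrank
import Mathlib.LinearAlgebra.FiniteDimensional.Defs
import Mathlib.LinearAlgebra.FiniteDimensional.Lemmas
import Mathlib.Algebra.Group.Nat.Even
import HarnessLib

/-!
# Route `KolyvaginRoadThree`, deciding crux `ZhangSharpFrameAtThreeHL` (item stmt-BirchSwinnertonDyer-19574):
# W. Zhang's induction RELATIVISED to the levels it visits — the engine of the STRICT-SELMER method skeleton
# (cell `bsd-stepL`, seat `bsd-stepL-zhang3-p1` g5; `--supports stmt-BirchSwinnertonDyer-19574`, helper; companion of
# `KolyvaginRoadThreeZhangInduction.lean`, p446019 ∕ p446227 ∕ p446812)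

HONEST FRAMING. Pure linear algebra over an arbitrary field; nothing about elliptic curves, Heegner points or `p = 3`
is asserted; 0 defs, 0 facts, 0 `sorry`. PARTITION: O2@3 (B10) × A1 — none (composition engine; types nothing,
closes nothing).

WHY A SECOND ENGINE. Plan g25's verdict on the first method skeletons for 19574 (STATUS 2026-08-26 13:08Z): a single
stub «∃ abstract Zhang data (H, Sel, κ, …)» is a COSTUME of the crux unless the data are PINNED to arithmetic. In
W. Zhang's proof (Camb. J. Math. 2 (2014), pp. 240–241) the Selmer groups of the level-raised forms at the levels the
induction actually VISITS are computed inside `H¹(K, V)` as KERNELS OF LOCALISATION — *"the k₀-rational Selmer group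
is equal to the kernel of loc_{q₁}: Sel_{𝔭₁,0}(A₁/K) = Ker(loc_{q₁} : Sel_{𝔭,0}(A/K) → H¹_fin(K_{q₁}, V))"*, and
again at `q₂`. Hence the data CAN be pinned in today's tree vocabulary: `Sel n` := the `p`-Selmer group of `E/K` made
STRICT (localisation zero; tree Selmer structures ∕ `torsionLocalKer`) at the primes of `n` — which IS Zhang's
`Sel_{𝔭_n,0}(A_n/K)` at the «lowering» levels reached by successive rank-lowering steps, and is NOT it elsewhere. The
engine must therefore only ever be fed such levels: every input shape below is relativised to a predicate `Good` on
levels, with (A1) producing `Good (insert q n)` from `Good n`; the induction visits good levels only, and concludes at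
every good even level — in particular at `∅` when `Good ∅`. Second change: the finite-dimensionality of the relaxed
eigenspace is moved INTO the conclusion of (A3) — Zhang's Lemma 8.4 (3) relaxes at the whole base locus `B(κ)`, an
infinite set of primes in general, and it is the lemma's proof that shows the relaxed `−ε_ν`-eigenspace is
finite-dimensional — so no global finiteness hypothesis remains. Otherwise the proofs are those of the companion file,
verbatim, with the goodness bookkeeping threaded through.

* (A1) RANK LOWERING [Zhang Prop. 5.4 + Thm. 2.1 + Čebotarev; (9.1)–(9.2)] on good levels, producing good levels;
* (A2) CONGRUENCE TRANSPORT [Thm. 4.3, contrapositive] along two good lowering steps;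
* (A3) TRIANGULATION [Lemma 8.4 (1) + (3), with finiteness] at good even levels;
* (A4) RELAXATION [(9.3)] between consecutive good levels;
* (A5) BASE CASE [Thm. 7.2] and (A6) PARITY [Thm. 9.2] at good even levels — (A6) again DERIVABLE from (A1) + (A6⁰).

References: [cite: WZhang2014, §9 proof of Thm. 9.1 (pp. 240–242), Lemma 8.4, Prop. 5.4, Thm. 4.3, Thm. 7.2, Thm. 9.2].
-/

namespace Summit.BirchSwinnertonDyer.Rank1Residual.X11b.Three.Koly.ZhangInductionOn

open Module

variable {F : Type*} [Field F] {H : Type*} [AddCommGroup H] [Module F H]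
  {Q : Type*} [DecidableEq Q] {M : Type*}

/-- A submodule of positive dimension has a non-zero element. [folklore] -/
private theorem exists_mem_ne_zero_of_finrank_pos {S : Submodule F H} (h : 0 < finrank F S) :
    ∃ c ∈ S, c ≠ 0 := by
  by_contra hc
  push Not at hc
  have hbot : S = ⊥ := (Submodule.eq_bot_iff S).mpr hc
  rw [hbot, finrank_bot] at h
  exact lt_irrefl 0 h

omit [DecidableEq Q] in
/-- The total rank does not depend on which eigenspace is listed first. [folklore] -/
private theorem rank_symm (Sel : Finset Q → Bool → Submodule F H) (n : Finset Q) (μ : Bool) :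
    finrank F (Sel n μ) + finrank F (Sel n (!μ)) = finrank F (Sel n true) + finrank F (Sel n false) := by
  cases μ
  · rw [Bool.not_false, add_comm]
  · rw [Bool.not_true]

set_option maxHeartbeats 400000 in
/-- **Zhang's induction on GOOD levels** (Camb. J. Math. 2 (2014), proof of Thm. 9.1, relativised). Data as in
`ZhangInduction.exists_ne_zero_of_zhangInduction` plus a predicate `Good` on levels; every input shape is assumed only
at good levels, (A1) produces good levels, and the finite-dimensionality of the relaxed eigenspace is part of the
conclusion of (A3). Conclusion: at every GOOD level of even cardinality some class `κ m n` is non-zero. Proof =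
Zhang's: pick the larger eigenspace `μ` (parity), lower the rank twice inside it (A1) to a good even level `n q₁ q₂`
of rank `r − 2`, apply the induction hypothesis there, and transport back by (A2) unless `q₂` is a base point — which
(A3) + (A4) exclude in both cases `s = μ` and `s = −μ` ((9.1)–(9.4)). Uniform in `F`; no hypothesis on any prime.
[cite: WZhang2014, §9 proof of Thm. 9.1, Lemma 8.4, Prop. 5.4, Thm. 4.3, Thm. 7.2, Thm. 9.2] -/
theorem exists_ne_zero_of_zhangInduction_on (Good : Finset Q → Prop)
    (Sel : Finset Q → Bool → Submodule F H) (SelRel : Finset Q → Set Q → Bool → Submodule F H)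
    (B : Finset Q → Set Q) (κ : M → Finset Q → H) (m₁ : M)
    -- (A1) rank lowering at a fresh prime, staying inside the good levels, eigen-bookkeeping (9.1)–(9.2)
    (hA1 : ∀ (n : Finset Q) (μ : Bool) (c : H), Good n → c ∈ Sel n μ → c ≠ 0 →
      ∃ q, q ∉ n ∧ Good (insert q n) ∧ c ∉ Sel (insert q n) μ ∧ Sel (insert q n) μ ≤ Sel n μ ∧
        finrank F (Sel (insert q n) μ) + 1 = finrank F (Sel n μ) ∧ Sel (insert q n) (!μ) = Sel n (!μ))
    -- (A2) cohomological congruence, contrapositive form, along two good lowering steps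
    (hA2 : ∀ (n : Finset Q) (q₁ q₂ : Q), Good n → Good (insert q₁ n) → Good (insert q₂ (insert q₁ n)) →
      q₁ ∉ n → q₂ ∉ insert q₁ n → q₂ ∉ B (insert q₂ (insert q₁ n)) → ∃ m, κ m n ≠ 0)
    -- (A3) triangulation at a good even level carrying a non-zero class (finiteness of the relaxed space included)
    (hA3 : ∀ (n : Finset Q), Good n → Even n.card → (∃ m, κ m n ≠ 0) →
      ∃ (s : Bool) (d : ℕ), finrank F (Sel n s) = d + 1 ∧ Sel n s = SelRel n (B n) s ∧
        FiniteDimensional F (SelRel n (B n) (!s)) ∧ finrank F (SelRel n (B n) (!s)) ≤ d)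
    -- (A4) relaxation: good levels n and n ∪ {q} differ only at q
    (hA4 : ∀ (n : Finset Q) (q : Q) (S : Set Q) (s : Bool), Good n → Good (insert q n) → q ∉ n → q ∈ S →
      Sel n s ≤ SelRel (insert q n) S s)
    -- (A5) base case at good even levels: Selmer rank one
    (hA5 : ∀ (n : Finset Q), Good n → Even n.card →
      finrank F (Sel n true) + finrank F (Sel n false) = 1 → κ m₁ n ≠ 0)
    -- (A6) parity at good even levels
    (hA6 : ∀ (n : Finset Q), Good n → Even n.card → Odd (finrank F (Sel n true) + finrank F (Sel n false))) :
    ∀ (n : Finset Q), Good n → Even n.card → ∃ m, κ m n ≠ 0 := by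
  suffices hmain : ∀ (k : ℕ) (n : Finset Q), Good n → finrank F (Sel n true) + finrank F (Sel n false) = k →
      Even n.card → ∃ m, κ m n ≠ 0 from fun n hg hn ↦ hmain _ n hg rfl hn
  intro k
  induction k using Nat.strong_induction_on with
  | _ k ih =>
    intro n hg hk hn
    have hodd := hA6 n hg hn
    by_cases h1 : finrank F (Sel n true) + finrank F (Sel n false) = 1
    · exact ⟨m₁, hA5 n hg hn h1⟩
    have h3 : 3 ≤ finrank F (Sel n true) + finrank F (Sel n false) := by
      obtain ⟨t, ht⟩ := hodd
      omega
    obtain ⟨μ, hμ⟩ : ∃ μ : Bool, finrank F (Sel n (!μ)) < finrank F (Sel n μ) := by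
      by_cases hlt : finrank F (Sel n false) < finrank F (Sel n true)
      · exact ⟨true, by rw [Bool.not_true]; exact hlt⟩
      · refine ⟨false, ?_⟩
        have hne : finrank F (Sel n true) ≠ finrank F (Sel n false) := by
          intro heq
          obtain ⟨t, ht⟩ := hodd
          omega
        rw [Bool.not_false]
        omega
    have hsum := rank_symm Sel n μ
    have hμ2 : 2 ≤ finrank F (Sel n μ) := by omega
    -- first rank lowering, at q₁ (the new level is good)
    obtain ⟨c₁, hc₁, hc₁0⟩ := exists_mem_ne_zero_of_finrank_pos (S := Sel n μ) (by omega)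
    obtain ⟨q₁, hq₁n, hg₁, -, -, hrk₁, hneg₁⟩ := hA1 n μ c₁ hg hc₁ hc₁0
    -- second rank lowering, at q₂, killing a non-zero c₂ ∈ Sel (n ∪ {q₁}) μ (the new level is good)
    obtain ⟨c₂, hc₂, hc₂0⟩ := exists_mem_ne_zero_of_finrank_pos (S := Sel (insert q₁ n) μ) (by omega)
    obtain ⟨q₂, hq₂n, hg₂, hc₂out, hle₂, hrk₂, hneg₂⟩ := hA1 (insert q₁ n) μ c₂ hg₁ hc₂ hc₂0
    set n₁ := insert q₁ n with hn₁
    set n₂ := insert q₂ n₁ with hn₂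
    have hcard : n₂.card = n.card + 2 := by
      rw [hn₂, Finset.card_insert_of_notMem hq₂n, hn₁, Finset.card_insert_of_notMem hq₁n]
    have hn₂even : Even n₂.card := by
      obtain ⟨t, ht⟩ := hn
      exact ⟨t + 1, by rw [hcard]; omega⟩
    have hsum₂ := rank_symm Sel n₂ μ
    have hrank₂ : finrank F (Sel n₂ true) + finrank F (Sel n₂ false) + 2 = k := by
      rw [← hsum₂, hneg₂, hneg₁, ← hk, ← hsum]
      omega
    obtain ⟨m', hm'⟩ := ih _ (by omega) n₂ hg₂ rfl hn₂even
    -- transport down by (A2) unless q₂ is a base point of the level-n₂ system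
    refine hA2 n q₁ q₂ hg hg₁ hg₂ hq₁n hq₂n fun hq₂B ↦ ?_
    obtain ⟨s, d, hs1, hs2, hs3fin, hs3⟩ := hA3 n₂ hg₂ hn₂even ⟨m', hm'⟩
    by_cases hsμ : s = μ
    · -- case (1): the killed class c₂ would lie in Sel n₂ μ
      subst hsμ
      have hincl : Sel n₁ s ≤ SelRel n₂ (B n₂) s := hA4 n₁ q₂ (B n₂) s hg₁ hg₂ hq₂n hq₂B
      exact hc₂out (hs2 ▸ hincl hc₂)
    · -- case (2): dimension count (9.1)–(9.4)
      have hs : s = !μ := by cases s <;> cases μ <;> simp_all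
      subst hs
      have hincl : Sel n₁ μ ≤ SelRel n₂ (B n₂) μ := hA4 n₁ q₂ (B n₂) μ hg₁ hg₂ hq₂n hq₂B
      have hfin' : FiniteDimensional F (SelRel n₂ (B n₂) μ) := by
        rw [Bool.not_not] at hs3fin
        exact hs3fin
      have hle : finrank F (Sel n₁ μ) ≤ finrank F (SelRel n₂ (B n₂) μ) := Submodule.finrank_mono hincl
      have hs3' : finrank F (SelRel n₂ (B n₂) μ) ≤ d := by rw [Bool.not_not] at hs3; exact hs3
      rw [hneg₂, hneg₁] at hs1
      omega

/-- **Parity on good levels from rank lowering and a non-zero rank** (Zhang Thm. 9.2, relativised): if (A1) holds on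
good levels (producing good levels) and the Selmer rank at a good even level is never `0`, then it is odd at every
good even level. [cite: WZhang2014, Thm. 9.2 and Thm. 7.1] -/
theorem odd_rank_of_rankLowering_on (Good : Finset Q → Prop)
    (Sel : Finset Q → Bool → Submodule F H)
    (hA1 : ∀ (n : Finset Q) (μ : Bool) (c : H), Good n → c ∈ Sel n μ → c ≠ 0 →
      ∃ q, q ∉ n ∧ Good (insert q n) ∧ c ∉ Sel (insert q n) μ ∧ Sel (insert q n) μ ≤ Sel n μ ∧
        finrank F (Sel (insert q n) μ) + 1 = finrank F (Sel n μ) ∧ Sel (insert q n) (!μ) = Sel n (!μ))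
    (hA6₀ : ∀ (n : Finset Q), Good n → Even n.card → finrank F (Sel n true) + finrank F (Sel n false) ≠ 0) :
    ∀ (n : Finset Q), Good n → Even n.card → Odd (finrank F (Sel n true) + finrank F (Sel n false)) := by
  suffices hmain : ∀ (k : ℕ) (n : Finset Q), Good n → finrank F (Sel n true) + finrank F (Sel n false) = k →
      Even n.card → Odd k from fun n hg hn ↦ hmain _ n hg rfl hn
  intro k
  induction k using Nat.strong_induction_on with
  | _ k ih =>
    intro n hg hk hn
    by_contra hkodd
    have hkeven : Even k := Nat.not_odd_iff_even.mp hkodd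
    have hk0 : k ≠ 0 := hk ▸ hA6₀ n hg hn
    have hk2 : 2 ≤ k := by obtain ⟨t, ht⟩ := hkeven; omega
    obtain ⟨μ, hμ⟩ : ∃ μ : Bool, 1 ≤ finrank F (Sel n μ) := by
      by_cases h : 1 ≤ finrank F (Sel n true)
      · exact ⟨true, h⟩
      · exact ⟨false, by omega⟩
    obtain ⟨c₁, hc₁, hc₁0⟩ := exists_mem_ne_zero_of_finrank_pos (S := Sel n μ) (by omega)
    obtain ⟨q₁, hq₁n, hg₁, -, -, hrk₁, hneg₁⟩ := hA1 n μ c₁ hg hc₁ hc₁0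
    have hsum := rank_symm Sel n μ
    have hsum₁ := rank_symm Sel (insert q₁ n) μ
    obtain ⟨μ', hμ'⟩ : ∃ μ' : Bool, 1 ≤ finrank F (Sel (insert q₁ n) μ') := by
      by_cases h : 1 ≤ finrank F (Sel (insert q₁ n) μ)
      · exact ⟨μ, h⟩
      · refine ⟨!μ, ?_⟩
        rw [hneg₁]
        omega
    obtain ⟨c₂, hc₂, hc₂0⟩ := exists_mem_ne_zero_of_finrank_pos (S := Sel (insert q₁ n) μ') (by omega)
    obtain ⟨q₂, hq₂n, hg₂, -, -, hrk₂, hneg₂⟩ := hA1 (insert q₁ n) μ' c₂ hg₁ hc₂ hc₂0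
    have hsum₁' := rank_symm Sel (insert q₁ n) μ'
    have hsum₂ := rank_symm Sel (insert q₂ (insert q₁ n)) μ'
    have hcard : (insert q₂ (insert q₁ n)).card = n.card + 2 := by
      rw [Finset.card_insert_of_notMem hq₂n, Finset.card_insert_of_notMem hq₁n]
    have heven₂ : Even (insert q₂ (insert q₁ n)).card := by
      obtain ⟨t, ht⟩ := hn
      exact ⟨t + 1, by rw [hcard]; omega⟩
    have hrank₂ : finrank F (Sel (insert q₂ (insert q₁ n)) true) +
        finrank F (Sel (insert q₂ (insert q₁ n)) false) + 2 = k := by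
      rw [← hsum₂, hneg₂, ← hk, ← hsum, ← hneg₁] at *
      omega
    have hodd₂ := ih (k - 2) (by omega) (insert q₂ (insert q₁ n)) hg₂ (by omega) heven₂
    obtain ⟨t, ht⟩ := hkeven
    obtain ⟨t', ht'⟩ := hodd₂
    omega

/-- **Zhang's induction on good levels with parity DERIVED**: (A1)–(A5) on good levels and (A6⁰) «the Selmer rank at a
good even level is non-zero» give a non-zero class at every good even level. [cite: WZhang2014, §9 proof of Thm. 9.1
and Thm. 9.2] -/
theorem exists_ne_zero_of_zhangInduction_on_of_rank_ne_zero (Good : Finset Q → Prop)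
    (Sel : Finset Q → Bool → Submodule F H) (SelRel : Finset Q → Set Q → Bool → Submodule F H)
    (B : Finset Q → Set Q) (κ : M → Finset Q → H) (m₁ : M)
    (hA1 : ∀ (n : Finset Q) (μ : Bool) (c : H), Good n → c ∈ Sel n μ → c ≠ 0 →
      ∃ q, q ∉ n ∧ Good (insert q n) ∧ c ∉ Sel (insert q n) μ ∧ Sel (insert q n) μ ≤ Sel n μ ∧
        finrank F (Sel (insert q n) μ) + 1 = finrank F (Sel n μ) ∧ Sel (insert q n) (!μ) = Sel n (!μ))
    (hA2 : ∀ (n : Finset Q) (q₁ q₂ : Q), Good n → Good (insert q₁ n) → Good (insert q₂ (insert q₁ n)) →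
      q₁ ∉ n → q₂ ∉ insert q₁ n → q₂ ∉ B (insert q₂ (insert q₁ n)) → ∃ m, κ m n ≠ 0)
    (hA3 : ∀ (n : Finset Q), Good n → Even n.card → (∃ m, κ m n ≠ 0) →
      ∃ (s : Bool) (d : ℕ), finrank F (Sel n s) = d + 1 ∧ Sel n s = SelRel n (B n) s ∧
        FiniteDimensional F (SelRel n (B n) (!s)) ∧ finrank F (SelRel n (B n) (!s)) ≤ d)
    (hA4 : ∀ (n : Finset Q) (q : Q) (S : Set Q) (s : Bool), Good n → Good (insert q n) → q ∉ n → q ∈ S →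
      Sel n s ≤ SelRel (insert q n) S s)
    (hA5 : ∀ (n : Finset Q), Good n → Even n.card →
      finrank F (Sel n true) + finrank F (Sel n false) = 1 → κ m₁ n ≠ 0)
    (hA6₀ : ∀ (n : Finset Q), Good n → Even n.card → finrank F (Sel n true) + finrank F (Sel n false) ≠ 0) :
    ∀ (n : Finset Q), Good n → Even n.card → ∃ m, κ m n ≠ 0 :=
  exists_ne_zero_of_zhangInduction_on Good Sel SelRel B κ m₁ hA1 hA2 hA3 hA4 hA5
    (odd_rank_of_rankLowering_on Good Sel hA1 hA6₀)

/-- **At the bottom level, on good levels**: if the starting level `∅` is good, (A1)–(A6) relativised to good levels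
give a non-zero class `κ m ∅`. [cite: WZhang2014, Thm. 9.1] -/
theorem exists_ne_zero_at_bottom_of_zhangInduction_on (Good : Finset Q → Prop) (hgood : Good ∅)
    (Sel : Finset Q → Bool → Submodule F H) (SelRel : Finset Q → Set Q → Bool → Submodule F H)
    (B : Finset Q → Set Q) (κ : M → Finset Q → H) (m₁ : M)
    (hA1 : ∀ (n : Finset Q) (μ : Bool) (c : H), Good n → c ∈ Sel n μ → c ≠ 0 →
      ∃ q, q ∉ n ∧ Good (insert q n) ∧ c ∉ Sel (insert q n) μ ∧ Sel (insert q n) μ ≤ Sel n μ ∧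
        finrank F (Sel (insert q n) μ) + 1 = finrank F (Sel n μ) ∧ Sel (insert q n) (!μ) = Sel n (!μ))
    (hA2 : ∀ (n : Finset Q) (q₁ q₂ : Q), Good n → Good (insert q₁ n) → Good (insert q₂ (insert q₁ n)) →
      q₁ ∉ n → q₂ ∉ insert q₁ n → q₂ ∉ B (insert q₂ (insert q₁ n)) → ∃ m, κ m n ≠ 0)
    (hA3 : ∀ (n : Finset Q), Good n → Even n.card → (∃ m, κ m n ≠ 0) →
      ∃ (s : Bool) (d : ℕ), finrank F (Sel n s) = d + 1 ∧ Sel n s = SelRel n (B n) s ∧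
        FiniteDimensional F (SelRel n (B n) (!s)) ∧ finrank F (SelRel n (B n) (!s)) ≤ d)
    (hA4 : ∀ (n : Finset Q) (q : Q) (S : Set Q) (s : Bool), Good n → Good (insert q n) → q ∉ n → q ∈ S →
      Sel n s ≤ SelRel (insert q n) S s)
    (hA5 : ∀ (n : Finset Q), Good n → Even n.card →
      finrank F (Sel n true) + finrank F (Sel n false) = 1 → κ m₁ n ≠ 0)
    (hA6 : ∀ (n : Finset Q), Good n → Even n.card → Odd (finrank F (Sel n true) + finrank F (Sel n false))) :
    ∃ m, κ m ∅ ≠ 0 :=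
  exists_ne_zero_of_zhangInduction_on Good Sel SelRel B κ m₁ hA1 hA2 hA3 hA4 hA5 hA6 ∅ hgood (by simp)


/-! ## Unrelativised corollaries (all levels good): the v1 engine with finiteness moved into (A3)

For a skeleton whose `Sel n` is canonical at EVERY level (koly's ordinary-condition spaces, `Method2`) no `Good`
predicate is needed, but the v1 engine's global hypothesis `hfin : ∀ n S μ, FiniteDimensional (SelRel n S μ)` is
UNSATISFIABLE there: relaxing at an infinite set `S` of admissible primes gives an infinite-dimensional space
(Poitou–Tate Euler characteristic). The corollaries below are what such a skeleton's `_of` should call: finiteness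
is asked only of the one relaxed eigenspace Lemma 8.4 (3) speaks about, inside (A3). -/

/-- **Zhang's induction, all levels, finiteness inside (A3).** [cite: WZhang2014, §9 proof of Thm. 9.1, Lemma 8.4] -/
theorem exists_ne_zero_of_zhangInduction_fin
    (Sel : Finset Q → Bool → Submodule F H) (SelRel : Finset Q → Set Q → Bool → Submodule F H)
    (B : Finset Q → Set Q) (κ : M → Finset Q → H) (m₁ : M)
    (hA1 : ∀ (n : Finset Q) (μ : Bool) (c : H), c ∈ Sel n μ → c ≠ 0 →
      ∃ q, q ∉ n ∧ c ∉ Sel (insert q n) μ ∧ Sel (insert q n) μ ≤ Sel n μ ∧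
        finrank F (Sel (insert q n) μ) + 1 = finrank F (Sel n μ) ∧ Sel (insert q n) (!μ) = Sel n (!μ))
    (hA2 : ∀ (n : Finset Q) (q₁ q₂ : Q), q₁ ∉ n → q₂ ∉ insert q₁ n →
      q₂ ∉ B (insert q₂ (insert q₁ n)) → ∃ m, κ m n ≠ 0)
    (hA3 : ∀ (n : Finset Q), Even n.card → (∃ m, κ m n ≠ 0) →
      ∃ (s : Bool) (d : ℕ), finrank F (Sel n s) = d + 1 ∧ Sel n s = SelRel n (B n) s ∧
        FiniteDimensional F (SelRel n (B n) (!s)) ∧ finrank F (SelRel n (B n) (!s)) ≤ d)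
    (hA4 : ∀ (n : Finset Q) (q : Q) (S : Set Q) (s : Bool), q ∉ n → q ∈ S → Sel n s ≤ SelRel (insert q n) S s)
    (hA5 : ∀ (n : Finset Q), Even n.card → finrank F (Sel n true) + finrank F (Sel n false) = 1 → κ m₁ n ≠ 0)
    (hA6 : ∀ (n : Finset Q), Even n.card → Odd (finrank F (Sel n true) + finrank F (Sel n false))) :
    ∀ (n : Finset Q), Even n.card → ∃ m, κ m n ≠ 0 := fun n hn ↦
  exists_ne_zero_of_zhangInduction_on (fun _ ↦ True) Sel SelRel B κ m₁
    (fun n μ c _ hc hc0 ↦ by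
      obtain ⟨q, h1, h2, h3, h4, h5⟩ := hA1 n μ c hc hc0
      exact ⟨q, h1, trivial, h2, h3, h4, h5⟩)
    (fun n q₁ q₂ _ _ _ ↦ hA2 n q₁ q₂) (fun n _ ↦ hA3 n) (fun n q S s _ _ ↦ hA4 n q S s) (fun n _ ↦ hA5 n)
    (fun n _ ↦ hA6 n) n trivial hn

/-- **Zhang's induction, all levels, finiteness inside (A3), parity DERIVED from (A1) + (A6⁰).**
[cite: WZhang2014, §9 proof of Thm. 9.1 and Thm. 9.2] -/
theorem exists_ne_zero_of_zhangInduction_fin_of_rank_ne_zero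
    (Sel : Finset Q → Bool → Submodule F H) (SelRel : Finset Q → Set Q → Bool → Submodule F H)
    (B : Finset Q → Set Q) (κ : M → Finset Q → H) (m₁ : M)
    (hA1 : ∀ (n : Finset Q) (μ : Bool) (c : H), c ∈ Sel n μ → c ≠ 0 →
      ∃ q, q ∉ n ∧ c ∉ Sel (insert q n) μ ∧ Sel (insert q n) μ ≤ Sel n μ ∧
        finrank F (Sel (insert q n) μ) + 1 = finrank F (Sel n μ) ∧ Sel (insert q n) (!μ) = Sel n (!μ))
    (hA2 : ∀ (n : Finset Q) (q₁ q₂ : Q), q₁ ∉ n → q₂ ∉ insert q₁ n →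
      q₂ ∉ B (insert q₂ (insert q₁ n)) → ∃ m, κ m n ≠ 0)
    (hA3 : ∀ (n : Finset Q), Even n.card → (∃ m, κ m n ≠ 0) →
      ∃ (s : Bool) (d : ℕ), finrank F (Sel n s) = d + 1 ∧ Sel n s = SelRel n (B n) s ∧
        FiniteDimensional F (SelRel n (B n) (!s)) ∧ finrank F (SelRel n (B n) (!s)) ≤ d)
    (hA4 : ∀ (n : Finset Q) (q : Q) (S : Set Q) (s : Bool), q ∉ n → q ∈ S → Sel n s ≤ SelRel (insert q n) S s)
    (hA5 : ∀ (n : Finset Q), Even n.card → finrank F (Sel n true) + finrank F (Sel n false) = 1 → κ m₁ n ≠ 0)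
    (hA6₀ : ∀ (n : Finset Q), Even n.card → finrank F (Sel n true) + finrank F (Sel n false) ≠ 0) :
    ∀ (n : Finset Q), Even n.card → ∃ m, κ m n ≠ 0 := fun n hn ↦
  exists_ne_zero_of_zhangInduction_on_of_rank_ne_zero (fun _ ↦ True) Sel SelRel B κ m₁
    (fun n μ c _ hc hc0 ↦ by
      obtain ⟨q, h1, h2, h3, h4, h5⟩ := hA1 n μ c hc hc0
      exact ⟨q, h1, trivial, h2, h3, h4, h5⟩)
    (fun n q₁ q₂ _ _ _ ↦ hA2 n q₁ q₂) (fun n _ ↦ hA3 n) (fun n q S s _ _ ↦ hA4 n q S s) (fun n _ ↦ hA5 n)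
    (fun n _ ↦ hA6₀ n) n trivial hn

end Summit.BirchSwinnertonDyer.Rank1Residual.X11b.Three.Koly.ZhangInductionOn
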